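import Summits.QuantumFields.BalabanUV.Beta.RemainderExplicitHistoryDiagonalLawEverywhere

/-!
# RemainderExplicitHistoryDiagonalSubsolution — ROAD P3, ORDER-0 PROFILE FAMILY: THE LOWER LAW AT EVERY POSITION WITH THE ULTRAVIOLET FEEDBACK
# KEPT, AND THE SUBSOLUTION PRINCIPLE — for two pinned runs (A: `K` steps, B: `K + n` steps, `Wγ < b`) at EVERY position `j₀ < K`:
# `d_{j₀} ≥ (1−Wγ∕b)·( (8κ₂K√(b₂(K−j₀)))⁻¹·Σ_{a≤j₀+n} ρ(a)min(a,K)(min(a,K)−j₀)₊ + Σ_{i<j₀} d_i·(R(K−i) − R(j₀−i))∕(8b₂(K−i)√(b₂(K−i))) )`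
# (the feedback is bounded BELOW: `g^A_i − g^B_{i+n} ≥ (g^A_i)³d_i∕8` since `d_i(g^A_i)² ≤ Wγ∕b < 1`, and `(g^A_i)³ ≥ (b₂(K−i))^{−3∕2}`), hence `d ≥ m` for
# EVERY subsolution `m` of the lower comparison recursion — the mirror of the third file's supersolution principle: at every position `d` lies between
# the solutions of two explicit profile-only renewal recursions whose coefficients differ by constants (`1−Wγ∕b` vs `C_w`, `1∕(8κ₂√b₂)` vs `4κ∕√b`,
# `1∕(8b₂√b₂)` vs `1∕(2b√b)`); for bounded memory the feedback keeps `d_{j₀} > 0` beyond the memory length, where the second file's local law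
# gives `0`; §4 is the family form at every `(m, n)` (fifth file of station S-d4p3-g52-1 «the law at every position»)

Cell `pub-balaban`, β-function sub-cell, BINDER row D4 «RemainderConst leaves for Bałaban's split» (`HOME/BINDER-OWNERS.md`; owner lineage
`b2b-balaban-beta-an4`; this file by co-owner #3 lineage `b2b-balaban-beta-d4-p3`, road P3 «the reduction road», generation 52, station
S-d4p3-g52-1, fifth file; imports the station's second file `RemainderExplicitHistoryDiagonalLawEverywhere`), β-FLOW TEAM duty (1); FREEZE (0)
honoured (def-free module in road P3's own `RemainderExplicit*` series; no leaf, no interface, no Literature file).  SOURCE OF THE SHAPES ONLY: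
[Balaban1987RG1] (0.20) p. 256, (0.31) and Thm 2 p. 259, §5 p. 298.  [folklore] real analysis about ONE explicit toy family (ours), road P3's
ORDER-0 PROFILE FAMILY `β_{k+1} = b + Σ_{i≤k} ρ(k−i)·min(g_k, |g_k − g_i|)` (generation 44), memory PROFILE `ρ ≥ 0` summable (`Σ_{a<N} ρ_a ≤ W`).
HONEST FRAMING: *"Discharging BetaPertH makes Bałaban's UV stability UNCONDITIONAL — a real constructive-QFT result; it is NOT the continuum
limit and NOT the Clay problem."*  THIS FILE DISCHARGES NOTHING OF THE KIND; nothing of Bałaban's (1.22) is asserted or constructed; row D4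
class UNCHANGED (critical-path width 0; instance 0∕1; D4 DISCHARGE NO DATE); NOT B12 Thm 2, NOT BetaPertH, NOT continuum, NOT Clay.  HONEST
DEPENDENCY: continuum YM on T⁴ ⇐ BetaPertH ∧ nine spine estimates (0/9 proved); BetaPertH ⇐ (D1) ∧ (D4) ∧ CAP+tail; G-an2-4 gates asym, D1
and NE2/3/4.  ABSOLUTE RULE: nothing is cited as a fact.  All letters NOT-IN-PRINT; `BetaFlowAsPrinted S` records a Markov β_n only.
WHAT IS PROVED ([folklore]; 0 sorry; 0 `def`; `d_j = 1∕(g^B_{j+n})² − 1∕(g^A_j)²`, `R(k) = Σ_{a<k} ρ(a)`, `b₂ = 1∕(g^A_K)² + b + Wγ` = `1∕g_IR² + b + Wγ`, `κ₂ = b₂∕b`):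
§1 `disc_le_linear` (`d_i ≤ Wγ(K−i)`), `disc_mul_sq_le` (`d_i(g^A_i)² ≤ Wγ∕b`), **`gap_ge_cube_mul_disc`** (`Wγ ≤ b` ⇒ `e_i ≥ ((g^A_i)³∕8)d_i`; generation 48's
`mul_min_le_gap`), `cube_ge_inv`, `inWindow_ge_neg` (the window's own term `≥ −(Wγ∕b)P`; generation 50's `sum_gap_le`); §2 **`disc_lower_everywhere_feedback`**
(the display); §3 **`disc_ge_subsolution`**; §4 **`astar_sub_invSq_lower_feedback`** (pinned family, every `m ≥ 1`, `n`, `N`: the display with `K = n+m`,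
`j₀ = n`, `d_{j₀} ↦ astar g m − invSq g m n` and the feedback's `d_i ↦ astar g (n+m−i) − invSq g (n+m−i) i` — the same family's cutoff discrepancies).
-/

noncomputable section

open Finset Filter Topology

namespace Summit.QuantumFields.BalabanUV.Beta.RemainderExplicitHistoryDiagonalSubsolution

open Literature.MathematicalPhysics.QuantumFieldTheory.Balaban1983to89
open Literature.MathematicalPhysics.QuantumFieldTheory.Balaban1983to89.FlowStep
open Literature.MathematicalPhysics.QuantumFieldTheory.Balaban1983to89.T4CouplingMatching
open Literature.MathematicalPhysics.QuantumFieldTheory.Balaban1983to89.T4ContinuumCoupling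
open Summit.QuantumFields.BalabanUV.Beta.RemainderExplicitHistoryDiagonalMonotone (continuum_monotone)
open Summit.QuantumFields.BalabanUV.Beta.RemainderExplicitHistoryDiagonalWeights
open Summit.QuantumFields.BalabanUV.Beta.RemainderExplicitHistoryDiagonalSource (inv_sq_between)
open Summit.QuantumFields.BalabanUV.Beta.RemainderExplicitHistoryDiagonalTwoRun (invSq_le_invSq_shift_run)
open Summit.QuantumFields.BalabanUV.Beta.RemainderExplicitHistoryDiagonalWindow (window_identity partialSum_mono)
open Summit.QuantumFields.BalabanUV.Beta.RemainderExplicitHistoryDiagonalComparison (sum_gap_le max_disc_le_disc_div)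
open Summit.QuantumFields.BalabanUV.Beta.RemainderExplicitHistoryDiagonalSourceEverywhere (le_srcFrom)

variable {β : HBeta} {b γ W : ℝ} {ρ : ℕ → ℝ}

/-! ## §1 The feedback from below: the gap is at least the cube times the discrepancy over eight -/

/-- THE DISCREPANCY IS AT MOST LINEAR IN THE INFRARED DISTANCE: two runs of the family in ]0,γ] (A: `K` steps, B: `K + n` steps) pinned
`g^A_K = g^B_{K+n}`, `ρ ≥ 0`, `Σ_{a<N} ρ_a ≤ W`; then `1∕(g^B_{i+n})² − 1∕(g^A_i)² ≤ Wγ·(K − i)` for `i ≤ K` (B's recursion variable grows by at most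
`(b + Wγ)` per step towards the ultraviolet, A's by at least `b` — generation 48's `inv_sq_between`). [cite: Balaban1987RG1, (0.31) p.259] -/
theorem disc_le_linear
    (hβ : ∀ (k : ℕ) (p : Fin (k + 1) → ℝ),
      β k p = b + ∑ i : Fin (k + 1), ρ (k - i) * min (p (Fin.last k)) (|p (Fin.last k) - p i|))
    (hρ0 : ∀ a, 0 ≤ ρ a) (hρW : ∀ n, ∑ a ∈ range n, ρ a ≤ W) {K n : ℕ} {gA gB : ℕ → ℝ}
    (hA : RGEqH K β gA) (hB : RGEqH (K + n) β gB) (hAbox : ∀ k, k ≤ K → 0 < gA k ∧ gA k ≤ γ)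
    (hBbox : ∀ k, k ≤ K + n → 0 < gB k ∧ gB k ≤ γ) (hpin : gA K = gB (K + n)) {i : ℕ} (hi : i ≤ K) :
    1 / (gB (i + n)) ^ 2 - 1 / (gA i) ^ 2 ≤ W * γ * ((K - i : ℕ) : ℝ) := by
  have hAi := (inv_sq_between hβ hρ0 hρW hA hAbox hi le_rfl).1
  have hBi := (inv_sq_between hβ hρ0 hρW hB hBbox (show i + n ≤ K + n by omega) le_rfl).2
  rw [show K + n - (i + n) = K - i by omega, ← hpin] at hBi
  nlinarith

/-- `d_i·(g^A_i)² ≤ Wγ∕b` for `i < K`: the short run's coupling obeys `1∕(g^A_i)² ≥ b(K−i)`, the discrepancy `≤ Wγ(K−i)`. [cite: Balaban1987RG1, (0.31) p.259] -/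
theorem disc_mul_sq_le
    (hβ : ∀ (k : ℕ) (p : Fin (k + 1) → ℝ),
      β k p = b + ∑ i : Fin (k + 1), ρ (k - i) * min (p (Fin.last k)) (|p (Fin.last k) - p i|))
    (hb : 0 < b) (hρ0 : ∀ a, 0 ≤ ρ a) (hρW : ∀ n, ∑ a ∈ range n, ρ a ≤ W) {K n : ℕ} {gA gB : ℕ → ℝ}
    (hA : RGEqH K β gA) (hB : RGEqH (K + n) β gB) (hAbox : ∀ k, k ≤ K → 0 < gA k ∧ gA k ≤ γ)
    (hBbox : ∀ k, k ≤ K + n → 0 < gB k ∧ gB k ≤ γ) (hpin : gA K = gB (K + n)) {i : ℕ} (hi : i < K) :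
    (1 / (gB (i + n)) ^ 2 - 1 / (gA i) ^ 2) * (gA i) ^ 2 ≤ W * γ / b := by
  have hd := disc_le_linear hβ hρ0 hρW hA hB hAbox hBbox hpin hi.le
  have hAi := (inv_sq_between hβ hρ0 hρW hA hAbox hi.le le_rfl).1
  have hx := (hAbox i hi.le).1
  have hxK := (hAbox K le_rfl).1
  have hs : (1 : ℝ) ≤ ((K - i : ℕ) : ℝ) := by exact_mod_cast (show 1 ≤ K - i by omega)
  have hW : 0 ≤ W := by simpa using hρW 0
  have hγ0 : 0 ≤ γ := le_trans hx.le (hAbox i hi.le).2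
  have hsq : (gA i) ^ 2 * (b * ((K - i : ℕ) : ℝ)) ≤ 1 := by
    have h1 : b * ((K - i : ℕ) : ℝ) ≤ 1 / (gA i) ^ 2 := by
      have : 0 ≤ 1 / (gA K) ^ 2 := by positivity
      linarith
    have := mul_le_mul_of_nonneg_left h1 (pow_pos hx 2).le
    rwa [mul_one_div_cancel (pow_pos hx 2).ne'] at this
  rw [le_div_iff₀ hb]
  calc (1 / (gB (i + n)) ^ 2 - 1 / (gA i) ^ 2) * (gA i) ^ 2 * b
      ≤ W * γ * ((K - i : ℕ) : ℝ) * (gA i) ^ 2 * b := by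
        have := invSq_le_invSq_shift_run hβ hb hρ0 hA hB (fun k hk => (hAbox k hk).1) (fun k hk => (hBbox k hk).1) hpin i hi.le
        nlinarith [mul_nonneg (pow_pos hx 2).le hb.le]
    _ = W * γ * ((gA i) ^ 2 * (b * ((K - i : ℕ) : ℝ))) := by ring
    _ ≤ W * γ * 1 := mul_le_mul_of_nonneg_left hsq (by positivity)
    _ = W * γ := mul_one _

/-- **THE GAP FROM BELOW BY THE DISCREPANCY** (`Wγ ≤ b`): `g^A_i − g^B_{i+n} ≥ ((g^A_i)³∕8)·d_i` for `i < K` — generation 48's `mul_min_le_gap`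
(`(x∕8)·min(1, L·x²) ≤ x − x′` at `L = d_i`), the minimum being `d_i(g^A_i)²` itself since `d_i(g^A_i)² ≤ Wγ∕b ≤ 1`. [cite: Balaban1987RG1, (0.31) p.259] -/
theorem gap_ge_cube_mul_disc
    (hβ : ∀ (k : ℕ) (p : Fin (k + 1) → ℝ),
      β k p = b + ∑ i : Fin (k + 1), ρ (k - i) * min (p (Fin.last k)) (|p (Fin.last k) - p i|))
    (hb : 0 < b) (hρ0 : ∀ a, 0 ≤ ρ a) (hρW : ∀ n, ∑ a ∈ range n, ρ a ≤ W) (hsmall : W * γ ≤ b) {K n : ℕ} {gA gB : ℕ → ℝ}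
    (hA : RGEqH K β gA) (hB : RGEqH (K + n) β gB) (hAbox : ∀ k, k ≤ K → 0 < gA k ∧ gA k ≤ γ)
    (hBbox : ∀ k, k ≤ K + n → 0 < gB k ∧ gB k ≤ γ) (hpin : gA K = gB (K + n)) {i : ℕ} (hi : i < K) :
    (gA i) ^ 3 / 8 * (1 / (gB (i + n)) ^ 2 - 1 / (gA i) ^ 2) ≤ gA i - gB (i + n) := by
  have hx := (hAbox i hi.le).1
  have hx' := (hBbox (i + n) (by omega)).1
  have hdom := invSq_le_invSq_shift_run hβ hb hρ0 hA hB (fun k hk => (hAbox k hk).1) (fun k hk => (hBbox k hk).1) hpin i hi.le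
  set L : ℝ := 1 / (gB (i + n)) ^ 2 - 1 / (gA i) ^ 2 with hL
  have hL0 : 0 ≤ L := by rw [hL]; linarith
  have h := mul_min_le_gap hx' hx hL0 (by rw [hL]; linarith)
  have hmin : min 1 (L * (gA i) ^ 2) = L * (gA i) ^ 2 := by
    refine min_eq_right ?_
    have := disc_mul_sq_le hβ hb hρ0 hρW hA hB hAbox hBbox hpin hi
    have hx1 : W * γ / b ≤ 1 := (div_le_one hb).mpr hsmall
    rw [← hL] at this
    linarith
  rw [hmin] at h
  calc (gA i) ^ 3 / 8 * L = gA i / 8 * (L * (gA i) ^ 2) := by ring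
    _ ≤ gA i - gB (i + n) := h

/-- THE CUBE FROM BELOW: on a box run of `K` steps, `(g_i)³ ≥ 1∕(b₂(K−i)·√(b₂(K−i)))` for `i < K`, `b₂ = 1∕(g_K)² + (b + Wγ)` (`1∕(g_i)² ≤ b₂(K−i)` by
generation 48's `inv_sq_between`). [cite: Balaban1987RG1, (0.31) p.259] -/
theorem cube_ge_inv
    (hβ : ∀ (k : ℕ) (p : Fin (k + 1) → ℝ),
      β k p = b + ∑ i : Fin (k + 1), ρ (k - i) * min (p (Fin.last k)) (|p (Fin.last k) - p i|))
    (hb : 0 < b) (hρ0 : ∀ a, 0 ≤ ρ a) (hρW : ∀ n, ∑ a ∈ range n, ρ a ≤ W) {K : ℕ} {g : ℕ → ℝ} (h : RGEqH K β g)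
    (hbox : ∀ k, k ≤ K → 0 < g k ∧ g k ≤ γ) {i : ℕ} (hi : i < K) :
    1 / ((1 / (g K) ^ 2 + (b + W * γ)) * ((K - i : ℕ) : ℝ) * Real.sqrt ((1 / (g K) ^ 2 + (b + W * γ)) * ((K - i : ℕ) : ℝ)))
      ≤ (g i) ^ 3 := by
  have hx := (hbox i hi.le).1
  have hxK := (hbox K le_rfl).1
  have hW : 0 ≤ W := by simpa using hρW 0
  have hγ0 : 0 ≤ γ := le_trans hx.le (hbox i hi.le).2
  have hs : (1 : ℝ) ≤ ((K - i : ℕ) : ℝ) := by exact_mod_cast (show 1 ≤ K - i by omega)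
  set b₂ : ℝ := 1 / (g K) ^ 2 + (b + W * γ) with hb₂
  have hb₂pos : 0 < b₂ := by rw [hb₂]; positivity
  have hup := (inv_sq_between hβ hρ0 hρW h hbox hi.le le_rfl).2
  have h1 : 1 / (g i) ^ 2 ≤ b₂ * ((K - i : ℕ) : ℝ) := by
    rw [hb₂, add_mul]
    have : 1 / (g K) ^ 2 ≤ 1 / (g K) ^ 2 * ((K - i : ℕ) : ℝ) := by
      have h0 : 0 ≤ 1 / (g K) ^ 2 := by positivity
      nlinarith
    linarith
  set y : ℝ := b₂ * ((K - i : ℕ) : ℝ) with hy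
  have hypos : 0 < y := by positivity
  have h2 : 1 / Real.sqrt y ≤ g i := by
    have hsq : (1 / Real.sqrt y) ^ 2 ≤ (g i) ^ 2 := by
      rw [one_div_pow, Real.sq_sqrt hypos.le]
      rw [one_div_le (by positivity) (pow_pos hx 2)]
      exact h1
    exact (pow_le_pow_iff_left₀ (by positivity) hx.le two_ne_zero).mp hsq
  have h3 : (1 / Real.sqrt y) ^ 3 ≤ (g i) ^ 3 := pow_le_pow_left₀ (by positivity) h2 3
  have e : (1 / Real.sqrt y) ^ 3 = 1 / (y * Real.sqrt y) := by
    have hsy : Real.sqrt y * Real.sqrt y = y := Real.mul_self_sqrt hypos.le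
    have hsy0 : 0 < Real.sqrt y := Real.sqrt_pos.2 hypos
    rw [one_div_pow, pow_succ, sq, hsy]
  rw [e] at h3
  simpa [hy, mul_assoc] using h3

/-- THE WINDOW'S OWN TERM FROM BELOW: for two pinned runs in ]0,γ] and any bound `P ≥ 0` of `d` on `[j₀,K)`,
`−(Wγ∕b)·P ≤ Σ_{i∈[j₀,K)} e_i·(R(K−i) − R(i+1))` (each weight is `≥ −R(i+1) ≥ −W`, `e ≥ 0`, and `Σ_{[j₀,K)} e ≤ (γ∕b)·P` by generation 50's `sum_gap_le`).
[cite: Balaban1987RG1, (0.20) p.256, (0.31) p.259] -/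
theorem inWindow_ge_neg
    (hβ : ∀ (k : ℕ) (p : Fin (k + 1) → ℝ),
      β k p = b + ∑ i : Fin (k + 1), ρ (k - i) * min (p (Fin.last k)) (|p (Fin.last k) - p i|))
    (hb : 0 < b) (hγ : 0 < γ) (hρ0 : ∀ a, 0 ≤ ρ a) (hρW : ∀ n, ∑ a ∈ range n, ρ a ≤ W) {K n : ℕ} {gA gB : ℕ → ℝ}
    (hA : RGEqH K β gA) (hB : RGEqH (K + n) β gB) (hAbox : ∀ k, k ≤ K → 0 < gA k ∧ gA k ≤ γ)
    (hBpos : ∀ k, k ≤ K + n → 0 < gB k) (hpin : gA K = gB (K + n)) {j₀ : ℕ} {P : ℝ}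
    (hP : ∀ t, j₀ ≤ t → t < K → 1 / (gB (t + n)) ^ 2 - 1 / (gA t) ^ 2 ≤ P) (hP0 : 0 ≤ P) :
    -(W * γ / b * P) ≤ ∑ i ∈ Ico j₀ K, (gA i - gB (i + n)) * (∑ a ∈ range (K - i), ρ a - ∑ a ∈ range (i + 1), ρ a) := by
  have hApos : ∀ k, k ≤ K → 0 < gA k := fun k hk => (hAbox k hk).1
  have hW : 0 ≤ W := by simpa using hρW 0
  have hdom := invSq_le_invSq_shift_run hβ hb hρ0 hA hB hApos hBpos hpin
  have he : ∀ i, i ≤ K → 0 ≤ gA i - gB (i + n) := fun i hi => by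
    linarith [le_of_one_div_sq_le (hApos i hi) (hBpos (i + n) (by omega)) (hdom i hi)]
  have hgap := sum_gap_le hβ hb hγ hρ0 hA hB hAbox hBpos hpin (j := j₀) le_rfl hP hP0
  have hwin : -(W * ∑ i ∈ Ico j₀ K, (gA i - gB (i + n)))
      ≤ ∑ i ∈ Ico j₀ K, (gA i - gB (i + n)) * (∑ a ∈ range (K - i), ρ a - ∑ a ∈ range (i + 1), ρ a) := by
    rw [Finset.mul_sum, ← Finset.sum_neg_distrib]
    refine Finset.sum_le_sum fun i hi => ?_
    have hi' := Finset.mem_Ico.mp hi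
    have h1 := he i hi'.2.le
    have h2 : 0 ≤ ∑ a ∈ range (K - i), ρ a := Finset.sum_nonneg fun a _ => hρ0 a
    have h3 := hρW (i + 1)
    nlinarith
  have : W * ∑ i ∈ Ico j₀ K, (gA i - gB (i + n)) ≤ W * (γ / b * P) := mul_le_mul_of_nonneg_left hgap hW
  have e : W * (γ / b * P) = W * γ / b * P := by ring
  linarith

/-! ## §2 The lower law at every position with the feedback kept -/

/-- **THE LOWER LAW AT EVERY POSITION, FEEDBACK KEPT** (`Wγ < b`).  Two runs of the order-0 profile family in ]0,γ] (`b > 0`, `γ > 0`, `ρ ≥ 0`,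
`Σ_{a<N} ρ_a ≤ W`, `Wγ < b`) — A: `K` steps, B: `K + n` steps — pinned; `b₂ = 1∕(g^A_K)² + (b + Wγ)`, `κ₂ = b₂∕b`.  THEN at EVERY position `j₀ < K` and for every
`N ≤ j₀ + n + 1`:
`(1 − Wγ∕b)·( (1∕(8κ₂K√(b₂(K−j₀))))·Σ_{a<N} ρ(a)min(a,K)(min(a,K)−j₀)₊ + Σ_{i<j₀} ((1∕(8b₂(K−i)√(b₂(K−i))))·d_i·(R(K−i) − R(j₀−i)) )
≤ d_{j₀}`
— generation 49's `window_identity` with the source from below (first file's `le_srcFrom`), the feedback from BELOW (`gap_ge_cube_mul_disc`,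
`cube_ge_inv`) and the window's own term `≥ −(Wγ∕b)·d_{j₀}∕(1−Wγ∕b)` (`inWindow_ge_neg` with generation 50's window maximum), absorbed.
[cite: Balaban1987RG1, (0.20) p.256, (0.31) and Thm 2 p.259] -/
theorem disc_lower_everywhere_feedback
    (hβ : ∀ (k : ℕ) (p : Fin (k + 1) → ℝ),
      β k p = b + ∑ i : Fin (k + 1), ρ (k - i) * min (p (Fin.last k)) (|p (Fin.last k) - p i|))
    (hb : 0 < b) (hγ : 0 < γ) (hρ0 : ∀ a, 0 ≤ ρ a) (hρW : ∀ n, ∑ a ∈ range n, ρ a ≤ W) (hsmall : W * γ < b) {K n : ℕ}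
    {gA gB : ℕ → ℝ} (hA : RGEqH K β gA) (hB : RGEqH (K + n) β gB) (hAbox : ∀ k, k ≤ K → 0 < gA k ∧ gA k ≤ γ)
    (hBbox : ∀ k, k ≤ K + n → 0 < gB k ∧ gB k ≤ γ) (hpin : gA K = gB (K + n)) {j₀ : ℕ} (hj₀K : j₀ < K) {N : ℕ}
    (hN : N ≤ j₀ + n + 1) :
    (1 - W * γ / b)
        * (1 / (8 * ((1 / (gA K) ^ 2 + (b + W * γ)) / b * K
              * Real.sqrt ((1 / (gA K) ^ 2 + (b + W * γ)) * ((K - j₀ : ℕ) : ℝ))))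
            * ∑ a ∈ range N, ρ a * (min (a : ℝ) K * ((min a K - j₀ : ℕ) : ℝ))
          + ∑ i ∈ range j₀, 1 / (8 * ((1 / (gA K) ^ 2 + (b + W * γ)) * ((K - i : ℕ) : ℝ)
              * Real.sqrt ((1 / (gA K) ^ 2 + (b + W * γ)) * ((K - i : ℕ) : ℝ))))
            * (1 / (gB (i + n)) ^ 2 - 1 / (gA i) ^ 2) * (∑ a ∈ range (K - i), ρ a - ∑ a ∈ range (j₀ - i), ρ a))
      ≤ 1 / (gB (j₀ + n)) ^ 2 - 1 / (gA j₀) ^ 2 := by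
  have hApos : ∀ k, k ≤ K → 0 < gA k := fun k hk => (hAbox k hk).1
  have hBpos : ∀ k, k ≤ K + n → 0 < gB k := fun k hk => (hBbox k hk).1
  have hW : 0 ≤ W := by simpa using hρW 0
  have hx1 : W * γ / b < 1 := (div_lt_one hb).mpr hsmall
  have hc : 0 < 1 - W * γ / b := by linarith
  have hdom := invSq_le_invSq_shift_run hβ hb hρ0 hA hB hApos hBpos hpin
  set d₀ : ℝ := 1 / (gB (j₀ + n)) ^ 2 - 1 / (gA j₀) ^ 2 with hd₀
  have hd₀0 : 0 ≤ d₀ := by have := hdom j₀ hj₀K.le; rw [hd₀]; linarith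
  have hid := window_identity hβ hb hρ0 hA hB hApos hBpos hpin hj₀K.le
  have hsrc := le_srcFrom hβ hb hγ hρ0 hρW hB hBbox hj₀K hN
  rw [← hpin] at hsrc
  have hfb : ∑ i ∈ range j₀, 1 / (8 * ((1 / (gA K) ^ 2 + (b + W * γ)) * ((K - i : ℕ) : ℝ)
          * Real.sqrt ((1 / (gA K) ^ 2 + (b + W * γ)) * ((K - i : ℕ) : ℝ))))
        * (1 / (gB (i + n)) ^ 2 - 1 / (gA i) ^ 2) * (∑ a ∈ range (K - i), ρ a - ∑ a ∈ range (j₀ - i), ρ a)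
      ≤ ∑ i ∈ range j₀, (gA i - gB (i + n)) * (∑ a ∈ range (K - i), ρ a - ∑ a ∈ range (j₀ - i), ρ a) := by
    refine Finset.sum_le_sum fun i hi => ?_
    have hi' := Finset.mem_range.mp hi
    have hiK : i < K := hi'.trans hj₀K
    have hdi : 0 ≤ 1 / (gB (i + n)) ^ 2 - 1 / (gA i) ^ 2 := by linarith [hdom i hiK.le]
    have hw0 : 0 ≤ ∑ a ∈ range (K - i), ρ a - ∑ a ∈ range (j₀ - i), ρ a := by
      linarith [partialSum_mono hρ0 (show j₀ - i ≤ K - i by omega)]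
    refine mul_le_mul_of_nonneg_right ?_ hw0
    have hcube := cube_ge_inv hβ hb hρ0 hρW hA hAbox hiK
    have hgap := gap_ge_cube_mul_disc hβ hb hρ0 hρW hsmall.le hA hB hAbox hBbox hpin hiK
    calc 1 / (8 * ((1 / (gA K) ^ 2 + (b + W * γ)) * ((K - i : ℕ) : ℝ)
            * Real.sqrt ((1 / (gA K) ^ 2 + (b + W * γ)) * ((K - i : ℕ) : ℝ)))) * (1 / (gB (i + n)) ^ 2 - 1 / (gA i) ^ 2)
        = 1 / 8 * (1 / ((1 / (gA K) ^ 2 + (b + W * γ)) * ((K - i : ℕ) : ℝ)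
            * Real.sqrt ((1 / (gA K) ^ 2 + (b + W * γ)) * ((K - i : ℕ) : ℝ)))) * (1 / (gB (i + n)) ^ 2 - 1 / (gA i) ^ 2) := by
          rw [← one_div_mul_one_div]
      _ ≤ 1 / 8 * (gA i) ^ 3 * (1 / (gB (i + n)) ^ 2 - 1 / (gA i) ^ 2) :=
          mul_le_mul_of_nonneg_right (mul_le_mul_of_nonneg_left hcube (by norm_num)) hdi
      _ = (gA i) ^ 3 / 8 * (1 / (gB (i + n)) ^ 2 - 1 / (gA i) ^ 2) := by ring
      _ ≤ gA i - gB (i + n) := hgap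
  have hmax := max_disc_le_disc_div hβ hb hγ hρ0 hρW hsmall hA hB hAbox hBpos hpin j₀
  have hwin := inWindow_ge_neg hβ hb hγ hρ0 hρW hA hB hAbox hBpos hpin (j₀ := j₀) (P := d₀ / (1 - W * γ / b))
    (fun t h1 h2 => hmax t (Finset.mem_Icc.mpr ⟨h1, h2.le⟩)) (div_nonneg hd₀0 hc.le)
  have hsum : 1 / (8 * ((1 / (gA K) ^ 2 + (b + W * γ)) / b * K
          * Real.sqrt ((1 / (gA K) ^ 2 + (b + W * γ)) * ((K - j₀ : ℕ) : ℝ))))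
          * ∑ a ∈ range N, ρ a * (min (a : ℝ) K * ((min a K - j₀ : ℕ) : ℝ))
        + ∑ i ∈ range j₀, 1 / (8 * ((1 / (gA K) ^ 2 + (b + W * γ)) * ((K - i : ℕ) : ℝ)
            * Real.sqrt ((1 / (gA K) ^ 2 + (b + W * γ)) * ((K - i : ℕ) : ℝ))))
          * (1 / (gB (i + n)) ^ 2 - 1 / (gA i) ^ 2) * (∑ a ∈ range (K - i), ρ a - ∑ a ∈ range (j₀ - i), ρ a)
      ≤ d₀ + W * γ / b * (d₀ / (1 - W * γ / b)) := by
    rw [hd₀]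
    linarith [hid, hsrc, hfb, hwin]
  have e : d₀ + W * γ / b * (d₀ / (1 - W * γ / b)) = d₀ / (1 - W * γ / b) := by
    rw [eq_div_iff hc.ne', add_mul, mul_assoc, div_mul_cancel₀ _ hc.ne']
    ring
  rw [e] at hsum
  have := mul_le_mul_of_nonneg_left hsum hc.le
  rwa [mul_div_cancel₀ _ hc.ne'] at this

/-! ## §3 The subsolution principle -/

/-- **THE SUBSOLUTION PRINCIPLE** (`Wγ < b`).  Two pinned runs of the order-0 profile family in ]0,γ] (A: `K` steps, B: `K + n` steps), `b₂ = 1∕(g^A_K)² +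
(b + Wγ)`, `κ₂ = b₂∕b`.  IF `m : ℕ → ℝ` satisfies, for every `j₀ < K`, the lower comparison recursion
`m(j₀) ≤ (1 − Wγ∕b)·( (1∕(8κ₂K√(b₂(K−j₀))))·Σ_{a<j₀+n+1} ρ(a)min(a,K)(min(a,K)−j₀)₊
                + Σ_{i<j₀} (1∕(8b₂(K−i)√(b₂(K−i))))·m(i)·(R(K−i) − R(j₀−i)) )`,
THEN `m(j₀) ≤ d_{j₀}` for every `j₀ < K` — strong induction from the ultraviolet end on `disc_lower_everywhere_feedback`, the lower feedback
coefficients being nonnegative.  With the third file's `disc_le_supersolution`: at EVERY position the matched discrepancy lies between the solutions of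
two explicit profile-only renewal recursions whose coefficients differ by constants. [cite: Balaban1987RG1, (0.20) p.256, (0.31) and Thm 2 p.259] -/
theorem disc_ge_subsolution {m : ℕ → ℝ}
    (hβ : ∀ (k : ℕ) (p : Fin (k + 1) → ℝ),
      β k p = b + ∑ i : Fin (k + 1), ρ (k - i) * min (p (Fin.last k)) (|p (Fin.last k) - p i|))
    (hb : 0 < b) (hγ : 0 < γ) (hρ0 : ∀ a, 0 ≤ ρ a) (hρW : ∀ n, ∑ a ∈ range n, ρ a ≤ W) (hsmall : W * γ < b) {K n : ℕ}
    {gA gB : ℕ → ℝ} (hA : RGEqH K β gA) (hB : RGEqH (K + n) β gB) (hAbox : ∀ k, k ≤ K → 0 < gA k ∧ gA k ≤ γ)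
    (hBbox : ∀ k, k ≤ K + n → 0 < gB k ∧ gB k ≤ γ) (hpin : gA K = gB (K + n))
    (hm : ∀ j₀, j₀ < K →
      m j₀ ≤ (1 - W * γ / b)
        * (1 / (8 * ((1 / (gA K) ^ 2 + (b + W * γ)) / b * K
              * Real.sqrt ((1 / (gA K) ^ 2 + (b + W * γ)) * ((K - j₀ : ℕ) : ℝ))))
            * ∑ a ∈ range (j₀ + n + 1), ρ a * (min (a : ℝ) K * ((min a K - j₀ : ℕ) : ℝ))
          + ∑ i ∈ range j₀, 1 / (8 * ((1 / (gA K) ^ 2 + (b + W * γ)) * ((K - i : ℕ) : ℝ)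
              * Real.sqrt ((1 / (gA K) ^ 2 + (b + W * γ)) * ((K - i : ℕ) : ℝ))))
            * m i * (∑ a ∈ range (K - i), ρ a - ∑ a ∈ range (j₀ - i), ρ a))) :
    ∀ j₀, j₀ < K → m j₀ ≤ 1 / (gB (j₀ + n)) ^ 2 - 1 / (gA j₀) ^ 2 := by
  have hW : 0 ≤ W := by simpa using hρW 0
  have hx1 : W * γ / b < 1 := (div_lt_one hb).mpr hsmall
  have hc : 0 ≤ 1 - W * γ / b := by linarith
  have hxK := (hAbox K le_rfl).1
  intro j₀
  induction j₀ using Nat.strong_induction_on with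
  | _ j₀ ih =>
    intro hj₀K
    have h := disc_lower_everywhere_feedback hβ hb hγ hρ0 hρW hsmall hA hB hAbox hBbox hpin hj₀K (N := j₀ + n + 1) le_rfl
    have hfb : ∑ i ∈ range j₀, 1 / (8 * ((1 / (gA K) ^ 2 + (b + W * γ)) * ((K - i : ℕ) : ℝ)
              * Real.sqrt ((1 / (gA K) ^ 2 + (b + W * γ)) * ((K - i : ℕ) : ℝ))))
            * m i * (∑ a ∈ range (K - i), ρ a - ∑ a ∈ range (j₀ - i), ρ a)
        ≤ ∑ i ∈ range j₀, 1 / (8 * ((1 / (gA K) ^ 2 + (b + W * γ)) * ((K - i : ℕ) : ℝ)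
              * Real.sqrt ((1 / (gA K) ^ 2 + (b + W * γ)) * ((K - i : ℕ) : ℝ))))
            * (1 / (gB (i + n)) ^ 2 - 1 / (gA i) ^ 2) * (∑ a ∈ range (K - i), ρ a - ∑ a ∈ range (j₀ - i), ρ a) := by
      refine Finset.sum_le_sum fun i hi => ?_
      have hi' := Finset.mem_range.mp hi
      have hiK : i < K := hi'.trans hj₀K
      have hw0 : 0 ≤ ∑ a ∈ range (K - i), ρ a - ∑ a ∈ range (j₀ - i), ρ a := by
        linarith [partialSum_mono hρ0 (show j₀ - i ≤ K - i by omega)]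
      have hs0 : (0 : ℝ) < ((K - i : ℕ) : ℝ) := by exact_mod_cast (show 0 < K - i by omega)
      have hc0 : 0 ≤ 1 / (8 * ((1 / (gA K) ^ 2 + (b + W * γ)) * ((K - i : ℕ) : ℝ)
          * Real.sqrt ((1 / (gA K) ^ 2 + (b + W * γ)) * ((K - i : ℕ) : ℝ)))) := by positivity
      exact mul_le_mul_of_nonneg_right (mul_le_mul_of_nonneg_left (ih i hi' hiK) hc0) hw0
    exact (hm j₀ hj₀K).trans ((mul_le_mul_of_nonneg_left (add_le_add le_rfl hfb) hc).trans h)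

/-! ## §4 A pinned family: the lower law with the feedback kept, every infrared distance and every cutoff -/

/-- **ROAD P3 — THE RATE IN THE CUTOFF, LOWER SIDE WITH THE FEEDBACK KEPT, EVERY `(m, n)`** (`Wγ < b`).  A family `K ↦ g K` of runs of the order-0
profile family in ]0,γ] pinned at one `g_IR`; `b₂ = 1∕g_IR² + (b + Wγ)`, `κ₂ = b₂∕b`.  THEN for every `m ≥ 1`, every cutoff `n` and every `N`:
`(1−Wγ∕b)·( (1∕(8κ₂(n+m)√(b₂m)))·Σ_{a<N} ρ(a)min(a,n+m)(min(a,n+m)−n)₊ + Σ_{i<n} (astar g (n+m−i) − invSq g (n+m−i) i)·(R(n+m−i) − R(n−i))∕(8b₂(n+m−i)√(b₂(n+m−i))) )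
≤ astar g m − invSq g m n` — `disc_lower_everywhere_feedback` on the pairs (run `n+m`, run `n+m+n′`) at the position `n`, where the feedback's `d_i` are
the cutoff discrepancies of the SAME family at the infrared distances `n+m−i` and cutoffs `i`, then `n′ → ∞` termwise (generation 47's
`continuum_monotone`).  The mirror of the third file's `astar_sub_invSq_upper_transport`. [cite: Balaban1987RG1, (0.20) p.256, (0.31) and Thm 2 p.259] -/
theorem astar_sub_invSq_lower_feedback
    (hβ : ∀ (k : ℕ) (p : Fin (k + 1) → ℝ),
      β k p = b + ∑ i : Fin (k + 1), ρ (k - i) * min (p (Fin.last k)) (|p (Fin.last k) - p i|))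
    (hb : 0 < b) (hγ : 0 < γ) (hρ0 : ∀ a, 0 ≤ ρ a) (hρW : ∀ n, ∑ a ∈ range n, ρ a ≤ W) (hsmall : W * γ < b)
    {g : ℕ → ℕ → ℝ} {gIR : ℝ} (hrun : ∀ K, RGEqH K β (g K)) (hbox : ∀ K i, i ≤ K → 0 < g K i ∧ g K i ≤ γ)
    (hpin : ∀ K, g K K = gIR) {m : ℕ} (hm : 1 ≤ m) (n N : ℕ) :
    (1 - W * γ / b)
        * (1 / (8 * ((1 / gIR ^ 2 + (b + W * γ)) / b * ((n + m : ℕ) : ℝ)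
              * Real.sqrt ((1 / gIR ^ 2 + (b + W * γ)) * (m : ℝ))))
            * ∑ a ∈ range N, ρ a * (min (a : ℝ) ((n + m : ℕ) : ℝ) * ((min a (n + m) - n : ℕ) : ℝ))
          + ∑ i ∈ range n, 1 / (8 * ((1 / gIR ^ 2 + (b + W * γ)) * ((n + m - i : ℕ) : ℝ)
              * Real.sqrt ((1 / gIR ^ 2 + (b + W * γ)) * ((n + m - i : ℕ) : ℝ))))
            * (astar g (n + m - i) - invSq g (n + m - i) i) * (∑ a ∈ range (n + m - i), ρ a - ∑ a ∈ range (n - i), ρ a))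
      ≤ astar g m - invSq g m n := by
  have ht := (continuum_monotone hβ hb hγ hρ0 hρW hrun hbox hpin).1
  have hpair : ∀ n', N ≤ n + n' + 1 →
      (1 - W * γ / b)
        * (1 / (8 * ((1 / gIR ^ 2 + (b + W * γ)) / b * ((n + m : ℕ) : ℝ)
              * Real.sqrt ((1 / gIR ^ 2 + (b + W * γ)) * (m : ℝ))))
            * ∑ a ∈ range N, ρ a * (min (a : ℝ) ((n + m : ℕ) : ℝ) * ((min a (n + m) - n : ℕ) : ℝ))
          + ∑ i ∈ range n, 1 / (8 * ((1 / gIR ^ 2 + (b + W * γ)) * ((n + m - i : ℕ) : ℝ)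
              * Real.sqrt ((1 / gIR ^ 2 + (b + W * γ)) * ((n + m - i : ℕ) : ℝ))))
            * (invSq g (n + m - i) (i + n') - invSq g (n + m - i) i) * (∑ a ∈ range (n + m - i), ρ a - ∑ a ∈ range (n - i), ρ a))
      ≤ invSq g m (n + n') - invSq g m n := by
    intro n' hN
    have hA : RGEqH (n + m) β (g (n + m)) := hrun (n + m)
    have hB : RGEqH (n + m + n') β (g (n + m + n')) := hrun (n + m + n')
    have hpin' : g (n + m) (n + m) = g (n + m + n') (n + m + n') := by rw [hpin, hpin]
    have h := disc_lower_everywhere_feedback hβ hb hγ hρ0 hρW hsmall hA hB (hbox (n + m)) (hbox (n + m + n')) hpin'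
      (j₀ := n) (by omega) (N := N) hN
    rw [hpin, show n + m - n = m by omega] at h
    have e1 : 1 / (g (n + m + n') (n + n')) ^ 2 = invSq g m (n + n') := by
      rw [invSq_def, show n + n' + m = n + m + n' by omega]
    have e2 : 1 / (g (n + m) n) ^ 2 = invSq g m n := by rw [invSq_def]
    have e3 : ∀ i ∈ range n, 1 / (g (n + m + n') (i + n')) ^ 2 - 1 / (g (n + m) i) ^ 2
        = invSq g (n + m - i) (i + n') - invSq g (n + m - i) i := by
      intro i hi
      have hi' := Finset.mem_range.mp hi
      rw [invSq_def, invSq_def, show i + n' + (n + m - i) = n + m + n' by omega, show i + (n + m - i) = n + m by omega]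
    have e4 : ∑ i ∈ range n, 1 / (8 * ((1 / gIR ^ 2 + (b + W * γ)) * ((n + m - i : ℕ) : ℝ)
            * Real.sqrt ((1 / gIR ^ 2 + (b + W * γ)) * ((n + m - i : ℕ) : ℝ))))
          * (1 / (g (n + m + n') (i + n')) ^ 2 - 1 / (g (n + m) i) ^ 2) * (∑ a ∈ range (n + m - i), ρ a - ∑ a ∈ range (n - i), ρ a)
        = ∑ i ∈ range n, 1 / (8 * ((1 / gIR ^ 2 + (b + W * γ)) * ((n + m - i : ℕ) : ℝ)
            * Real.sqrt ((1 / gIR ^ 2 + (b + W * γ)) * ((n + m - i : ℕ) : ℝ))))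
          * (invSq g (n + m - i) (i + n') - invSq g (n + m - i) i) * (∑ a ∈ range (n + m - i), ρ a - ∑ a ∈ range (n - i), ρ a) :=
      Finset.sum_congr rfl fun i hi => by rw [e3 i hi]
    rw [e1, e2, e4] at h
    exact h
  have hR : Tendsto (fun n' => invSq g m (n + n') - invSq g m n) atTop (𝓝 (astar g m - invSq g m n)) :=
    ((ht m).comp ((tendsto_add_atTop_nat n).congr (fun n' => Nat.add_comm n' n))).sub_const _
  have hL : Tendsto (fun n' => (1 - W * γ / b)
        * (1 / (8 * ((1 / gIR ^ 2 + (b + W * γ)) / b * ((n + m : ℕ) : ℝ)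
              * Real.sqrt ((1 / gIR ^ 2 + (b + W * γ)) * (m : ℝ))))
            * ∑ a ∈ range N, ρ a * (min (a : ℝ) ((n + m : ℕ) : ℝ) * ((min a (n + m) - n : ℕ) : ℝ))
          + ∑ i ∈ range n, 1 / (8 * ((1 / gIR ^ 2 + (b + W * γ)) * ((n + m - i : ℕ) : ℝ)
              * Real.sqrt ((1 / gIR ^ 2 + (b + W * γ)) * ((n + m - i : ℕ) : ℝ))))
            * (invSq g (n + m - i) (i + n') - invSq g (n + m - i) i) * (∑ a ∈ range (n + m - i), ρ a - ∑ a ∈ range (n - i), ρ a)))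
      atTop (𝓝 ((1 - W * γ / b)
        * (1 / (8 * ((1 / gIR ^ 2 + (b + W * γ)) / b * ((n + m : ℕ) : ℝ)
              * Real.sqrt ((1 / gIR ^ 2 + (b + W * γ)) * (m : ℝ))))
            * ∑ a ∈ range N, ρ a * (min (a : ℝ) ((n + m : ℕ) : ℝ) * ((min a (n + m) - n : ℕ) : ℝ))
          + ∑ i ∈ range n, 1 / (8 * ((1 / gIR ^ 2 + (b + W * γ)) * ((n + m - i : ℕ) : ℝ)
              * Real.sqrt ((1 / gIR ^ 2 + (b + W * γ)) * ((n + m - i : ℕ) : ℝ))))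
            * (astar g (n + m - i) - invSq g (n + m - i) i) * (∑ a ∈ range (n + m - i), ρ a - ∑ a ∈ range (n - i), ρ a)))) := by
    refine Tendsto.const_mul _ (Tendsto.const_add _ (tendsto_finsetSum _ fun i _ => ?_))
    refine Tendsto.mul_const _ (Tendsto.const_mul _ (Tendsto.sub_const ?_ _))
    exact (ht (n + m - i)).comp ((tendsto_add_atTop_nat i).congr (fun n' => Nat.add_comm n' i))
  exact le_of_tendsto_of_tendsto hL hR (Filter.eventually_atTop.2 ⟨N, fun n' hn' => hpair n' (by omega)⟩)

end Summit.QuantumFields.BalabanUV.Beta.RemainderExplicitHistoryDiagonalSubsolution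

end
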